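import Literature.RepresentationTheory.KonnoKonno2007.JunctionContinuityRankOne
import Literature.RepresentationTheory.KonnoKonno2007.FockVacuumCharacterPrinted
import HarnessLib

/-!
# The printed-clauses record IS the landed record at the rank-one junctions (Konno–Konno 2007, Lemma 5.2; Folland 1989, §4.2)

Topic `RepresentationTheory/KonnoKonno2007`; namespace `Literature.RepresentationTheory.KonnoKonno2007.RealDualPair`.
`FockVacuumCharacterPrinted D e` (covariance, unitary lifts, printed vacuum values — NO continuity clause) and the
landed `FockVacuumCharacter D e` (the same plus (w1)) are EQUIVALENT at every concrete junction
`D := junction P Q R S` at which the tree's `KAK` descent applies — `U(P,Q)` of real rank `≤ 1` (`Q` a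
subsingleton) and `K_W ↠ U(R,S)` (`W` definite, or any surjective `UForm.kV R S`):

* `fockVacuumCharacter_junction_of_printed` / `fockVacuumCharacter_junction_iff_printed` (general rank-one junction);
* `…_of_isEmpty_right` / `…_of_isEmpty_left` (definite `W`);
* the cell's pair `U(2,1) × U(1)` (currency `DPIdx (Fin 2) Unit Unit Empty`):
  **`fockVacuumCharacter_ι₁_iff_printed : (junction (Fin 2) Unit Unit Empty).FockVacuumCharacter e ↔
  (junction (Fin 2) Unit Unit Empty).FockVacuumCharacterPrinted e`**.

The upgrade map is `JunctionContinuityRankOne.isArchWeilDatum_junction_rankOne_of_vacScalar` fed to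
`FockVacuumCharacterPrinted.fockVacuumCharacter_of_continuous_upgrade`; nothing is cited as a hypothesis.

## References

* [KonnoKonno2007] T. Konno, K. Konno, Kobe J. Math. 24 (2007), §3.3, Lemma 5.2 (i)/(ii) p. 73.
* [Folland1989] G. B. Folland, *Harmonic Analysis in Phase Space* (1989), §4.2 p. 156 (Schur remark), Prop. (4.39).

## Provenance

LEAN-IN-TREE rule (2026-08-18), pub-hodgecm model-construction sub-cell, seat mc-theta-2 gen 4 (closing the loop between
sub-node AX2-c′ `FockVacuumCharacterPrinted` and node (v19-d)(iii) `JunctionContinuityRankOne`).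
-/

set_option autoImplicit false

noncomputable section

open MeasureTheory Complex SchwartzMap Matrix
open scoped InnerProductSpace ComplexConjugate Real

namespace Literature.RepresentationTheory.KonnoKonno2007

namespace RealDualPair

open Literature.Analysis.SegalBargmann Literature.RepresentationTheory.HeisenbergGroup
open Literature.NumberTheory.Weil1964 Literature.NumberTheory.Automorphic
open Literature.NumberTheory.Automorphic.UnitaryGroup

section RankOne

variable {P Q R S : Type*} [Fintype P] [DecidableEq P] [Fintype Q] [DecidableEq Q] [Fintype R] [DecidableEq R]
  [Fintype S] [DecidableEq S]

/-- **Printed ⇒ landed at a rank-one junction**: `Q` a subsingleton, `K_W ↠ U(R,S)`.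
[cite: KonnoKonno2007, Lemma 5.2; Folland1989, §4.2 p. 156] -/
theorem fockVacuumCharacter_junction_of_printed [Subsingleton Q] (p₀ : P) (q₀ : Q) {e : VacExponents}
    (hW : Function.Surjective (UForm.kV R S)) (h : (junction P Q R S).FockVacuumCharacterPrinted e) :
    (junction P Q R S).FockVacuumCharacter e :=
  h.fockVacuumCharacter_of_continuous_upgrade fun ω hcov hlift hvac =>
    (isArchWeilDatum_junction_rankOne_of_vacScalar p₀ q₀ ω hcov hlift hvac hW).continuous_apply

/-- **Printed ⇔ landed at a rank-one junction.** [cite: KonnoKonno2007, Lemma 5.2; Folland1989, §4.2 p. 156] -/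
theorem fockVacuumCharacter_junction_iff_printed [Subsingleton Q] (p₀ : P) (q₀ : Q) {e : VacExponents}
    (hW : Function.Surjective (UForm.kV R S)) :
    (junction P Q R S).FockVacuumCharacter e ↔ (junction P Q R S).FockVacuumCharacterPrinted e :=
  ⟨RealDualPairJunction.FockVacuumCharacter.printed, fockVacuumCharacter_junction_of_printed p₀ q₀ hW⟩

/-- **Definite `W` on the right** (`S` empty). [cite: KonnoKonno2007, Lemma 5.2; Folland1989, §4.2 p. 156] -/
theorem fockVacuumCharacter_junction_iff_printed_of_isEmpty_right [Subsingleton Q] [IsEmpty S] (p₀ : P) (q₀ : Q)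
    {e : VacExponents} :
    (junction P Q R S).FockVacuumCharacter e ↔ (junction P Q R S).FockVacuumCharacterPrinted e :=
  fockVacuumCharacter_junction_iff_printed p₀ q₀ UForm.kV_surjective_of_isEmpty_right

/-- **Definite `W` on the left** (`R` empty). [cite: KonnoKonno2007, Lemma 5.2; Folland1989, §4.2 p. 156] -/
theorem fockVacuumCharacter_junction_iff_printed_of_isEmpty_left [Subsingleton Q] [IsEmpty R] (p₀ : P) (q₀ : Q)
    {e : VacExponents} :
    (junction P Q R S).FockVacuumCharacter e ↔ (junction P Q R S).FockVacuumCharacterPrinted e :=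
  fockVacuumCharacter_junction_iff_printed p₀ q₀ UForm.kV_surjective_of_isEmpty_left

end RankOne

/-! ## The cell's pair `U(2,1) × U(1)` -/

section IotaOne

/-- **`U(2,1) × U(1)`: printed ⇒ landed.** [cite: KonnoKonno2007, §3.3, Lemma 5.2; Folland1989, §4.2 p. 156] -/
theorem fockVacuumCharacter_ι₁_of_printed {e : VacExponents}
    (h : (junction (Fin 2) Unit Unit Empty).FockVacuumCharacterPrinted e) :
    (junction (Fin 2) Unit Unit Empty).FockVacuumCharacter e :=
  fockVacuumCharacter_junction_of_printed (0 : Fin 2) () UForm.kV_surjective_of_isEmpty_right h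

/-- **`U(2,1) × U(1)`: the landed junction record and the printed-clauses record are EQUIVALENT.**
[cite: KonnoKonno2007, §3.3, Lemma 5.2; Folland1989, §4.2 p. 156] -/
theorem fockVacuumCharacter_ι₁_iff_printed {e : VacExponents} :
    (junction (Fin 2) Unit Unit Empty).FockVacuumCharacter e ↔
      (junction (Fin 2) Unit Unit Empty).FockVacuumCharacterPrinted e :=
  fockVacuumCharacter_junction_iff_printed_of_isEmpty_right (0 : Fin 2) ()

end IotaOne

end RealDualPair

end Literature.RepresentationTheory.KonnoKonno2007
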